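import Literature.AlgebraicGeometry.Resolution.ExceptionalCurveDegree
import Literature.AlgebraicGeometry.Resolution.ExceptionalCurvePoints
import Literature.AlgebraicGeometry.Resolution.Lipman1969ProperTransform
import Literature.AlgebraicGeometry.Resolution.Lipman1969IntersectionTheory
import Literature.AlgebraicGeometry.Resolution.Lipman1969RationalContractionRegime
import Literature.AlgebraicGeometry.Resolution.PrimeDivisorIdeals
import Literature.AlgebraicGeometry.Resolution.FiniteBirationalNormal
import Literature.AlgebraicGeometry.Motives.CartierDivisorOfIdealSheaf
import HarnessLib

/-!
# Crux `NoZenoR` (stmt-ResolutionOfSingularities-19943), slot 5 (B1), the (A4) contraction loop: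
# «(M) is monotone under domination» — `(E′·E′) ≤ (E·E)` for the strict transform `E′` of an
# exceptional curve `E` along a proper birational `g : X′ → X` of resolutions, and its `h⁰`-form

OURS (cell res-hironaka, crux chain W4.4, seat res-D-pv-045 gen 8; object (A4-num) CUT BY SIGNATURE by
res-L0-w44-lead-1 g8, 2026-08-27T19:54Z, placed by res-L0-w44-plan-1 DESK WORD 14); nothing here is a
statement of the manuscript under review (Hironaka 2017); AI-written, weaker than expert review.
SUPPORT-level, counted 0.  Def-free.  FACTS as explicit binders (BRICK RULE): `Lipman1969_15_a` (F-98 a))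
for the geometric inequality, `Lipman1969_13_1_d_rat` (F-97 d)) for the `h⁰`-translation; nothing else.

THE STATEMENT.  `S` a two-dimensional normal Noetherian local domain, `π : X → Spec S` a resolution,
`g : X′ → X` proper birational dominant with `ψ := g ≫ π` again a resolution, `E = E_η` an integral
exceptional curve of `π`, `E′ = E_{η′}` the integral exceptional curve of `ψ` with `g η′ = η` (the strict
transform).  Then `(E′·E′) ≤ (E·E)` (`excCurveDegree_strictTransform_le`), and over a RATIONAL `S`, if
`h⁰(E′) = h⁰(E)` then `h⁰(𝒪_{2E}) ≤ h⁰(𝒪_{2E′})` (`h0_sq_le_h0_sq_strictTransform`), so Lipman's criterion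
(M) `3·h⁰(E) < h⁰(𝒪_{2E})` passes from `E` to `E′` (`three_mul_h0_lt_h0_sq_strictTransform`).

THE PROOF.  `D := [E]`, `D′ := g^*D`, `D₁ := [E′]` (effective Cartier divisors of the invertible prime
ideal sheaves), `F := D′ + (−D₁)` with local equations `g♯d · e⁻¹`:
* §1 `g.stalkMap η′ : 𝒪_{X,η} → 𝒪_{X′,η′}` is BIJECTIVE: injective because `K(X) ↪ K(X′)`; surjective
  because `𝒪_{X,η}` is a valuation ring of `K(X) ≅ K(X′)` (`IsBirational.isIso_stalkMap_genericPoint`)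
  dominated by the local ring `𝒪_{X′,η′}` (an element outside the image has its inverse in `𝔪_η`, which
  maps into `𝔪_{η′}` — a unit, contradiction);
* §2 the local equations of `[𝓘]` generate the stalks `𝓘_y` (`ofIsEffectiveCartier` charts);
* §3 `F` is EFFECTIVE (at `y` below `η′`, `g♯d` is a non-unit at `η′` — `D` does not avoid `η = g η′` and
  stalk maps are local — so its germ lies in `(𝓘_{η′})_y = (e_y)`; elsewhere `e` is a unit) and AVOIDS `η′`
  (by §1 `g♯` maps `𝔪_η = (t)` onto `𝔪_{η′} = (e)`, so `g♯t / e` is a unit);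
* §4 `(F·E′) ≥ 0` (`excCurveDegree_nonneg_of_isEffective`), `(F·E′) = (D′·E′) − (D₁·E′)`
  (`excCurveDegree_add/neg`), `(D′·E′) = (D·E)` (F-98 a)) ⇒ `(E′·E′) ≤ (E·E)`;
* §5 F-97 d) on `X` and on `X′` (`(E·E) = 2h⁰(E) − h⁰(𝒪_{2E})`) and finiteness of these `h⁰`.

References: J. Lipman, *Rational singularities …*, Publ. Math. IHÉS 36 (1969), §13 (p. 223), §15 (p. 227),
§27 (pp. 275–278) [`Lipman1969`]; U. Görtz, T. Wedhorn, *Algebraic Geometry I* (2020), (11.9), Def. 11.49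
[`GortzWedhorn2020`].
-/

noncomputable section

-- single-problem summit: the doubled namespace component `ResolutionOfSingularities` is forced
set_option linter.dupNamespace false

namespace Summit.ResolutionOfSingularities.ResolutionOfSingularities.Theorems.NoZeno.ExcCount

open CategoryTheory AlgebraicGeometry TopologicalSpace IsLocalRing
open Literature.AlgebraicGeometry.Resolution Literature.AlgebraicGeometry.Motives
open Literature.AlgebraicGeometry.Motives.RatFn

universe u

/-! ## §1 Stalk maps of a birational morphism at points under a valuation ring -/

section StalkMap

variable {X X' : Scheme.{u}} [IsIntegral X] [IsIntegral X'] (g : X' ⟶ X) [IsDominant g]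

/-- The stalk maps of a dominant morphism of integral schemes are injective (`𝒪 ↪ K(X) ↪ K(X′)`).
[folklore] -/
theorem stalkMap_injective_of_isDominant (x' : X') : Function.Injective (g.stalkMap x') := by
  intro a b hab
  apply toFunctionField_injective (g.base x')
  apply (functionFieldMap g).injective
  rw [functionFieldMap_toFunctionField, functionFieldMap_toFunctionField]
  exact congrArg _ hab

omit [IsIntegral X] [IsIntegral X'] [IsDominant g] in
/-- Specialisation maps of stalks between two points specialising to each other are surjective.
[folklore] -/
theorem stalkSpecializes_surjective_of_specializes {x y : X} (h : x ⤳ y) (h' : y ⤳ x) :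
    Function.Surjective (X.presheaf.stalkSpecializes h) := fun t =>
  ⟨X.presheaf.stalkSpecializes h' t, by
    rw [← CommRingCat.comp_apply, TopCat.Presheaf.stalkSpecializes_comp]
    have : X.presheaf.stalkSpecializes (h.trans h') = 𝟙 _ :=
      TopCat.Presheaf.stalkSpecializes_refl X.presheaf x
    rw [this]
    rfl⟩

/-- For a birational dominant morphism of integral schemes the field map `g♯ : K(X) → K(X′)` is
surjective (hence bijective). [folklore] -/
theorem functionFieldMap_surjective_of_isBirational (hg : IsBirational g) :
    Function.Surjective (functionFieldMap g) := by
  haveI := hg.isIso_stalkMap_genericPoint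
  have h1 : Function.Surjective (g.stalkMap (genericPoint X')) :=
    (ConcreteCategory.bijective_of_isIso (g.stalkMap (genericPoint X'))).2
  have h2 : Function.Surjective (X.presheaf.stalkSpecializes (specializes_genericPoint g)) :=
    stalkSpecializes_surjective_of_specializes (specializes_genericPoint g)
      (specializes_of_eq (RatFn.genericPoint_eq_of_isDominant g).symm)
  intro b
  obtain ⟨c, rfl⟩ := h1 b
  obtain ⟨a, rfl⟩ := h2 c
  exact ⟨a, rfl⟩

/-- **A birational morphism is a local isomorphism at points lying under a valuation ring of the
target**: if `𝒪_{X, g x′}` is a valuation ring (e.g. the discrete valuation ring at a codimension-one point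
of a regular `X`), then `g.stalkMap x′ : 𝒪_{X, g x′} → 𝒪_{X′, x′}` is bijective — a valuation ring of
`K(X) ≅ K(X′)` is dominated by no local subring other than itself. [cite: StacksProject, Tag 00IB] -/
theorem stalkMap_bijective_of_isBirational (hg : IsBirational g) (x' : X')
    [ValuationRing (X.presheaf.stalk (g.base x'))] : Function.Bijective (g.stalkMap x') := by
  refine ⟨stalkMap_injective_of_isDominant g x', fun b => ?_⟩
  obtain ⟨k, hk⟩ := functionFieldMap_surjective_of_isBirational g hg (toFunctionField x' b)
  -- `k ∈ K(X) = Frac 𝒪_{X, g x′}`: either `k` or `k⁻¹` lies in the valuation ring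
  rcases ValuationRing.isInteger_or_isInteger (X.presheaf.stalk (g.base x')) k with ⟨a, ha⟩ | ⟨a, ha⟩
  · refine ⟨a, toFunctionField_injective x' ?_⟩
    rw [← functionFieldMap_toFunctionField, ← hk]
    exact congrArg _ ha
  · by_cases hk0 : k = 0
    · refine ⟨0, toFunctionField_injective x' ?_⟩
      rw [map_zero, map_zero, ← hk, hk0, map_zero]
    · -- `g♯ a = (g♯ k)⁻¹ = b⁻¹` in `K(X′)`, so `g♯_{x′} a · b = 1`: `g♯_{x′} a` is a unit, hence so is `a`
      have hb0 : toFunctionField x' b ≠ 0 := by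
        rw [← hk]
        exact (map_ne_zero _).mpr hk0
      have hab : g.stalkMap x' a * b = 1 := by
        apply toFunctionField_injective x'
        rw [map_mul, map_one, ← functionFieldMap_toFunctionField]
        change functionFieldMap g (algebraMap _ _ a) * _ = 1
        rw [ha, map_inv₀, hk, inv_mul_cancel₀ hb0]
      have hua : IsUnit (g.stalkMap x' a) := IsUnit.of_mul_eq_one _ hab
      have hua' : IsUnit a := (isUnit_map_iff (g.stalkMap x').hom a).mp hua
      -- `b = (g♯ a)⁻¹ = g♯ (a⁻¹)`
      refine ⟨((hua'.unit⁻¹ : (X.presheaf.stalk (g.base x'))ˣ) : X.presheaf.stalk (g.base x')), ?_⟩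
      have h1 : g.stalkMap x' ((hua'.unit⁻¹ : (X.presheaf.stalk (g.base x'))ˣ) : _) * g.stalkMap x' a = 1 := by
        rw [← map_mul, hua'.val_inv_mul, map_one]
      calc (g.stalkMap x') ↑hua'.unit⁻¹
          = (g.stalkMap x') ↑hua'.unit⁻¹ * (g.stalkMap x' a * b) := by rw [hab, mul_one]
        _ = ((g.stalkMap x') ↑hua'.unit⁻¹ * g.stalkMap x' a) * b := by ring
        _ = b := by rw [h1, one_mul]

/-- With the hypotheses of `stalkMap_bijective_of_isBirational`, the (local, bijective) stalk map carries
the maximal ideal ONTO the maximal ideal. [folklore] -/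
theorem map_maximalIdeal_stalkMap_eq (hg : IsBirational g) (x' : X')
    [ValuationRing (X.presheaf.stalk (g.base x'))] :
    (maximalIdeal (X.presheaf.stalk (g.base x'))).map (g.stalkMap x').hom =
      maximalIdeal (X'.presheaf.stalk x') := by
  have hbij := stalkMap_bijective_of_isBirational g hg x'
  apply le_antisymm
  · rw [Ideal.map_le_iff_le_comap]
    intro a ha
    have ha' : ¬ IsUnit a := ha
    rw [Ideal.mem_comap, mem_maximalIdeal, mem_nonunits_iff]
    exact fun hu => ha' ((isUnit_map_iff (g.stalkMap x').hom a).mp hu)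
  · intro b hb
    have hb' : ¬ IsUnit b := hb
    obtain ⟨a, rfl⟩ := hbij.2 b
    refine Ideal.mem_map_of_mem _ ?_
    rw [mem_maximalIdeal, mem_nonunits_iff]
    exact fun hu => hb' (hu.map (g.stalkMap x').hom)

end StalkMap

/-! ## §2 The local equations of `[𝓘]` generate the stalks of `𝓘` -/

section LocalEquation

variable {Y : Scheme.{u}} [IsIntegral Y] (I : Y.IdealSheafData) (hI : IsEffectiveCartier I)

/-- For the effective Cartier divisor `[𝓘] = ofIsEffectiveCartier I hI` and a point `y` of its chart `j`:
the local equation on that chart is the rational function of a germ `e_y ∈ 𝒪_{Y,y}` which GENERATES the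
stalk `𝓘_y`. [cite: GortzWedhorn2020, Remark 11.27 and (11.12) (pp. 378–379)] -/
theorem exists_germ_localEquation_span (j : Y) {y : Y} (hy : y ∈ (CartierDivisor.ofIsEffectiveCartier I hI).U j) :
    ∃ e : Y.presheaf.stalk y, toFunctionField y e = (CartierDivisor.ofIsEffectiveCartier I hI).f j ∧
      stalkIdeal I y = Ideal.span {e} := by
  refine ⟨Y.presheaf.germ _ y hy (CartierDivisor.cartierGen I hI j), ?_, ?_⟩
  · rw [CartierDivisor.ofIsEffectiveCartier_f]
    exact toFunctionField_germ_eq_secFn _ hy _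
  · rw [stalkIdeal_eq_map_germ I (CartierDivisor.cartierChart I hI j) hy, CartierDivisor.ideal_cartierChart,
      Ideal.map_span, Set.image_singleton]
    rfl

end LocalEquation

/-! ## §3 The divisor `F = g^*[E] − [E′]` is effective and avoids `η′` -/

section Divisor

variable {X X' : Scheme.{u}} [IsIntegral X] [IsIntegral X'] [IsLocallyNoetherian X] [IsLocallyNoetherian X']
  (g : X' ⟶ X) [IsDominant g] {η' : X'}
  (hF : IsEffectiveCartier (primeDivisorIdeal (g.base η'))) (hF' : IsEffectiveCartier (primeDivisorIdeal η'))

omit [IsLocallyNoetherian X] [IsLocallyNoetherian X'] in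
/-- **`F := g^*[E_{g η′}] + (−[E_{η′}])` is EFFECTIVE.**  At `y` with `η′ ⤳ y`: the pulled-back local
equation `g♯d` is a non-unit at `η′` (the divisor `[E]` does not avoid `g η′ ∈ E`, and stalk maps are local
homomorphisms), so its germ at `y` lies in `(𝓘_{E′})_y = 𝔭_{η′} = (e_y)` and `g♯d · e⁻¹` is regular at `y`;
at `y` with `η′ ̸⤳ y` the divisor `[E′]` avoids `y`, so `e` is a unit there.
[cite: GortzWedhorn2020, Section (11.9) (p. 374)] -/
theorem isEffective_pullback_add_neg :
    ((CartierDivisor.ofIsEffectiveCartier (primeDivisorIdeal (g.base η')) hF).pullback g +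
      -CartierDivisor.ofIsEffectiveCartier (primeDivisorIdeal η') hF').IsEffective := by
  rintro ⟨i, j⟩ y ⟨hyi, hyj⟩
  change IsRegularAt y (functionFieldMap g ((CartierDivisor.ofIsEffectiveCartier (primeDivisorIdeal (g.base η')) hF).f i) *
    ((CartierDivisor.ofIsEffectiveCartier (primeDivisorIdeal η') hF').f j)⁻¹)
  -- the pulled-back local equation is regular at `y`
  have hd : IsRegularAt y (functionFieldMap g ((CartierDivisor.ofIsEffectiveCartier (primeDivisorIdeal (g.base η')) hF).f i)) :=
    (CartierDivisor.isEffective_ofIsEffectiveCartier _ hF).pullback g i y hyi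
  obtain ⟨e, he, hspan⟩ := exists_germ_localEquation_span (primeDivisorIdeal η') hF' j hyj
  by_cases hsp : η' ⤳ y
  · obtain ⟨dy, hdy⟩ := hd
    -- `[E]` does not avoid `g η′`, so `g♯d` is not a unit at `η′`
    have hη'i : g.base η' ∈ (CartierDivisor.ofIsEffectiveCartier (primeDivisorIdeal (g.base η')) hF).U i :=
      (hsp.map g.continuous).mem_open
        ((CartierDivisor.ofIsEffectiveCartier (primeDivisorIdeal (g.base η')) hF).U i).2 hyi
    have hnot : ¬ IsUnitAt η' (functionFieldMap g ((CartierDivisor.ofIsEffectiveCartier (primeDivisorIdeal (g.base η')) hF).f i)) := by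
      intro hu
      have hreg : IsRegularAt (g.base η') ((CartierDivisor.ofIsEffectiveCartier (primeDivisorIdeal (g.base η')) hF).f i) :=
        CartierDivisor.isEffective_ofIsEffectiveCartier _ hF i _ hη'i
      have hav : (CartierDivisor.ofIsEffectiveCartier (primeDivisorIdeal (g.base η')) hF).Avoids (g.base η') :=
        CartierDivisor.Avoids.of_mem hη'i (hreg.isUnitAt_of_functionFieldMap hu)
      exact (CartierDivisor.avoids_ofIsEffectiveCartier_iff _ hF (g.base η')).mp hav
        ((mem_support_primeDivisorIdeal_iff (g.base η') (g.base η')).mpr specializes_rfl)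
    -- hence the germ `dy` at `y` lies in `𝔭_{η′} = (𝓘_{E′})_y = (e)`
    have hmem : dy ∈ stalkIdeal (primeDivisorIdeal η') y := by
      rw [stalkIdeal_primeDivisorIdeal hsp]
      change X'.presheaf.stalkSpecializes hsp dy ∈ maximalIdeal _
      rw [mem_maximalIdeal, mem_nonunits_iff]
      intro hunit
      apply hnot
      exact ⟨hunit.unit, by rw [IsUnit.unit_spec, toFunctionField_stalkSpecializes, hdy]⟩
    rw [hspan, Ideal.mem_span_singleton] at hmem
    obtain ⟨c, hc⟩ := hmem
    have he0 : toFunctionField y e ≠ 0 := by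
      rw [he]
      exact (CartierDivisor.ofIsEffectiveCartier (primeDivisorIdeal η') hF').f_ne_zero j
    refine ⟨c, ?_⟩
    rw [← hdy, hc, map_mul, he, mul_comm (((CartierDivisor.ofIsEffectiveCartier (primeDivisorIdeal η') hF').f j)),
      mul_assoc, mul_inv_cancel₀ ((CartierDivisor.ofIsEffectiveCartier (primeDivisorIdeal η') hF').f_ne_zero j),
      mul_one]
  · -- `[E′]` avoids `y`: its local equation is a unit at `y`
    have hav : (CartierDivisor.ofIsEffectiveCartier (primeDivisorIdeal η') hF').Avoids y :=
      (CartierDivisor.avoids_ofIsEffectiveCartier_iff _ hF' y).mpr (by rwa [mem_support_primeDivisorIdeal_iff])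
    exact hd.mul (hav j hyj).inv.isRegularAt

omit [IsLocallyNoetherian X] [IsLocallyNoetherian X'] in
/-- **`F := g^*[E_{g η′}] + (−[E_{η′}])` AVOIDS `η′`** when `g` is birational and `𝒪_{X, g η′}` is a
valuation ring: `g♯_{η′}` is bijective (§1) and carries `𝔪_{g η′} = (t)` onto `𝔪_{η′} = (e)`, so the local
equation `g♯t · e⁻¹` of `F` at `η′` is a unit. [cite: GortzWedhorn2020, Section (11.9) (p. 374)] -/
theorem avoids_pullback_add_neg (hg : IsBirational g) [ValuationRing (X.presheaf.stalk (g.base η'))] :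
    ((CartierDivisor.ofIsEffectiveCartier (primeDivisorIdeal (g.base η')) hF).pullback g +
      -CartierDivisor.ofIsEffectiveCartier (primeDivisorIdeal η') hF').Avoids η' := by
  obtain ⟨i, hi⟩ := (CartierDivisor.ofIsEffectiveCartier (primeDivisorIdeal (g.base η')) hF).covers (g.base η')
  obtain ⟨j, hj⟩ := (CartierDivisor.ofIsEffectiveCartier (primeDivisorIdeal η') hF').covers η'
  refine CartierDivisor.Avoids.of_mem (i := (i, j)) ⟨hi, hj⟩ ?_
  change IsUnitAt η' (functionFieldMap g ((CartierDivisor.ofIsEffectiveCartier (primeDivisorIdeal (g.base η')) hF).f i) *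
    ((CartierDivisor.ofIsEffectiveCartier (primeDivisorIdeal η') hF').f j)⁻¹)
  -- generators `t` of `𝔪_{g η′}` and `e` of `𝔪_{η′}` given by the two local equations
  obtain ⟨t, ht, htspan⟩ := exists_germ_localEquation_span (primeDivisorIdeal (g.base η')) hF i hi
  obtain ⟨e, he, hespan⟩ := exists_germ_localEquation_span (primeDivisorIdeal η') hF' j hj
  rw [stalkIdeal_primeDivisorIdeal_self] at htspan hespan
  -- `g♯_{η′}` maps `(t)` onto `(e)`
  have hmap := map_maximalIdeal_stalkMap_eq g hg η'
  rw [htspan, hespan, Ideal.map_span, Set.image_singleton] at hmap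
  obtain ⟨u, hu⟩ := Ideal.span_singleton_eq_span_singleton.mp hmap
  -- so `g♯t · e⁻¹ = u⁻¹` is a unit at `η′`
  have hu' : g.stalkMap η' t * (u : X'.presheaf.stalk η') = e := hu
  have he0 : e ≠ 0 := fun h => by
    apply (CartierDivisor.ofIsEffectiveCartier (primeDivisorIdeal η') hF').f_ne_zero j
    rw [← he, h, map_zero]
  have ht0 : g.stalkMap η' t ≠ 0 := fun h => he0 (by rw [← hu', h, zero_mul])
  have hφt : toFunctionField η' (g.stalkMap η' t) ≠ 0 :=
    (map_ne_zero_iff _ (toFunctionField_injective η')).mpr ht0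
  refine ⟨u⁻¹, ?_⟩
  rw [← ht, functionFieldMap_toFunctionField, ← he, ← hu', map_mul, map_units_inv, mul_inv, ← mul_assoc,
    mul_inv_cancel₀ hφt, one_mul]

end Divisor

/-! ## §4 `(E′·E′) ≤ (E·E)` -/

section Degree

variable {S : Type u} [CommRing S] [IsNoetherianRing S] [IsLocalRing S] [IsDomain S] [IsIntegrallyClosed S]
  {X X' : Scheme.{u}} [IsIntegral X] [IsIntegral X'] [IsLocallyNoetherian X] [IsLocallyNoetherian X']
  {π : X ⟶ Spec (.of S)}

/-- **(E′·E′) ≤ (E·E): the self-intersection does not increase under strict transform.**  `S` a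
two-dimensional normal Noetherian local domain, `π : X → Spec S` a resolution, `g : X′ → X` proper birational
dominant with `g ≫ π` a resolution, `η ∈ excCurvePoints π`, `η′ ∈ excCurvePoints (g ≫ π)` with `g η′ = η`
(so `E_{η′}` is the strict transform of `E_η`): `(E_{η′}·E_{η′})_{X′} ≤ (E_η·E_η)_X`.  Conditional on
Lipman §15 a) (F-98a, explicit binder); no rationality needed.
[cite: Lipman1969, Section 15, statement a) (p. 227)] -/
theorem excCurveDegree_strictTransform_le (h15a : Lipman1969_15_a.{u}) (hdim : ringKrullDim S = 2)
    (hπ : IsResolution π) (g : X' ⟶ X) [IsProper g] [IsDominant g] (hbir : IsBirational g)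
    (hψ : IsResolution (g ≫ π)) {η : X} (hη : η ∈ excCurvePoints π) {η' : X'}
    (hη' : η' ∈ excCurvePoints (g ≫ π)) (hg : g.base η' = η)
    (hF : IsEffectiveCartier (primeDivisorIdeal η)) (hF' : IsEffectiveCartier (primeDivisorIdeal η')) :
    excCurveDegree (g ≫ π) (CartierDivisor.ofIsEffectiveCartier (primeDivisorIdeal η') hF') η' ≤
      excCurveDegree π (CartierDivisor.ofIsEffectiveCartier (primeDivisorIdeal η) hF) η := by
  subst hg
  haveI : IsProper (g ≫ π) := hψ.isProper
  -- `𝒪_{X, g η′}` is a discrete valuation ring (regular, codimension one), hence a valuation ring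
  have hcoh : Order.coheight (g.base η') = 1 := IsResolution.coheight_eq_one_of_mem_excCurvePoints hdim hπ hη
  haveI : IsPrincipalIdealRing (X.presheaf.stalk (g.base η')) :=
    isPrincipalIdealRing_stalk_of_coheight_eq_one hπ.isRegular hcoh
  haveI : ValuationRing (X.presheaf.stalk (g.base η')) := inferInstance
  -- F-98 a): `(g^*[E] · E′) = ([E] · E)`
  have h15 := h15a S hdim X π hπ X' g ‹IsProper g› hbir hψ.isRegular
    (CartierDivisor.ofIsEffectiveCartier (primeDivisorIdeal (g.base η')) hF) (g.base η') hη η' rfl hη'.2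
  -- `F = g^*[E] − [E′]` is effective and avoids `η′`, so `(F·E′) ≥ 0`
  have hnn := excCurveDegree_nonneg_of_isEffective (g ≫ π) hη' (isEffective_pullback_add_neg g hF hF')
    (avoids_pullback_add_neg g hF hF' hbir)
  rw [excCurveDegree_add (g ≫ π) hη', excCurveDegree_neg (g ≫ π) hη', h15] at hnn
  linarith

end Degree

/-! ## §5 The `h⁰`-form over a rational singularity -/

section H0

variable {S : Type u} [CommRing S] [IsNoetherianRing S] [IsLocalRing S] [IsDomain S] [IsIntegrallyClosed S]
  {X X' : Scheme.{u}} [IsIntegral X] [IsIntegral X'] [IsLocallyNoetherian X] [IsLocallyNoetherian X']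
  {π : X ⟶ Spec (.of S)}

/-- **«(M) is monotone under domination», `h⁰`-form.**  With `S` RATIONAL in addition, if the strict
transform has the same `h⁰` — `h0 (g ≫ π) 𝓘_{η′} = h0 π 𝓘_η` (e.g. `E′ ≅ E`) — then
`h0 π (𝓘_η²) ≤ h0 (g ≫ π) (𝓘_{η′}²)`, i.e. `h⁰(𝒪_{2E}) ≤ h⁰(𝒪_{2E′})`: by F-97 d)
`(E·E) = 2·h⁰(E) − h⁰(𝒪_{2E})` on both resolutions and `(E′·E′) ≤ (E·E)`.  Conditional on F-97 d) and
F-98 a) (explicit binders). [cite: Lipman1969, Proposition (13.1) d) (p. 223) and Section 15 a) (p. 227)] -/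
theorem h0_sq_le_h0_sq_strictTransform (h131d : Lipman1969_13_1_d_rat.{u}) (h15a : Lipman1969_15_a.{u})
    (hdim : ringKrullDim S = 2) (hS : HasRationalSingularity S)
    (hπ : IsResolution π) (g : X' ⟶ X) [IsProper g] [IsDominant g] (hbir : IsBirational g)
    (hψ : IsResolution (g ≫ π)) {η : X} (hη : η ∈ excCurvePoints π) {η' : X'}
    (hη' : η' ∈ excCurvePoints (g ≫ π)) (hg : g.base η' = η) :
    h0 (g ≫ π) (primeDivisorIdeal η') = h0 π (primeDivisorIdeal η) →
      h0 π (primeDivisorIdeal η ^ 2) ≤ h0 (g ≫ π) (primeDivisorIdeal η' ^ 2) := by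
  intro hh0
  haveI : IsProper π := hπ.isProper
  haveI : IsProper (g ≫ π) := hψ.isProper
  -- the two prime divisors are Cartier (regular surfaces, codimension-one points)
  have hF : IsEffectiveCartier (primeDivisorIdeal η) := isEffectiveCartier_primeDivisorIdeal_of_isRegular
    hπ.isRegular (IsResolution.coheight_eq_one_of_mem_excCurvePoints hdim hπ hη)
  have hF' : IsEffectiveCartier (primeDivisorIdeal η') := isEffectiveCartier_primeDivisorIdeal_of_isRegular
    hψ.isRegular (IsResolution.coheight_eq_one_of_mem_excCurvePoints hdim hψ hη')
  have hle := excCurveDegree_strictTransform_le h15a hdim hπ g hbir hψ hη hη' hg hF hF'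
  -- F-97 d) on `X` and on `X′`
  rw [h131d S hdim hS X π hπ η hη η hη hF, h131d S hdim hS X' (g ≫ π) hψ η' hη' η' hη' hF', ← pow_two,
    ← pow_two, hh0] at hle
  -- finiteness of the `h⁰` involved
  have f1 : h0 π (primeDivisorIdeal η ^ 2) ≠ ⊤ := h0_pow_primeDivisorIdeal_ne_top π hη two_ne_zero
  have f2 : h0 (g ≫ π) (primeDivisorIdeal η' ^ 2) ≠ ⊤ := h0_pow_primeDivisorIdeal_ne_top (g ≫ π) hη' two_ne_zero
  have hnat : (h0 π (primeDivisorIdeal η ^ 2)).toNat ≤ (h0 (g ≫ π) (primeDivisorIdeal η' ^ 2)).toNat := by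
    omega
  rw [← ENat.coe_toNat f1, ← ENat.coe_toNat f2]
  exact_mod_cast hnat

/-- **COROLLARY — (M) passes to the strict transform.**  With the hypotheses of
`h0_sq_le_h0_sq_strictTransform` (rational `S`, `h0 (g ≫ π) 𝓘_{η′} = h0 π 𝓘_η`): Lipman's first-kind-free
criterion (M) `3 * h0 π 𝓘_η < h0 π (𝓘_η ^ 2)` for `E` implies (M) for `E′`.
[cite: Lipman1969, Corollary (27.3) (p. 277)] -/
theorem three_mul_h0_lt_h0_sq_strictTransform (h131d : Lipman1969_13_1_d_rat.{u}) (h15a : Lipman1969_15_a.{u})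
    (hdim : ringKrullDim S = 2) (hS : HasRationalSingularity S)
    (hπ : IsResolution π) (g : X' ⟶ X) [IsProper g] [IsDominant g] (hbir : IsBirational g)
    (hψ : IsResolution (g ≫ π)) {η : X} (hη : η ∈ excCurvePoints π) {η' : X'}
    (hη' : η' ∈ excCurvePoints (g ≫ π)) (hg : g.base η' = η)
    (hh0 : h0 (g ≫ π) (primeDivisorIdeal η') = h0 π (primeDivisorIdeal η))
    (hM : 3 * h0 π (primeDivisorIdeal η) < h0 π (primeDivisorIdeal η ^ 2)) :
    3 * h0 (g ≫ π) (primeDivisorIdeal η') < h0 (g ≫ π) (primeDivisorIdeal η' ^ 2) := by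
  rw [hh0]
  exact lt_of_lt_of_le hM (h0_sq_le_h0_sq_strictTransform h131d h15a hdim hS hπ g hbir hψ hη hη' hg hh0)

end H0

end Summit.ResolutionOfSingularities.ResolutionOfSingularities.Theorems.NoZeno.ExcCount

end
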